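import Summits.KontsevichZagierPeriods.KontsevichZagierPeriods.Theorems.HurwitzMicroSectorsNormalFormPrincipleM3KernelReduceHalfPoint
import Summits.KontsevichZagierPeriods.KontsevichZagierPeriods.Theorems.HurwitzMicroSectorsNormalFormPrincipleL2W3RelationsMoebiusTwo
import Summits.KontsevichZagierPeriods.KontsevichZagierPeriods.Theorems.HurwitzMicroSectorsNormalFormPrincipleM3WordsLogCube

/-!
# `NormalFormPrinciple` (stmt-KontsevichZagierPeriods-3869), line `SketchIdeator1` —
# M3 words kernel, package 2 of 4: the reductions of the words `abc`, `acb`, `cbb`, `cbc`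

Pure proof file (registered sub-goal `m3x_reduce_words_2` of the extended M3 kernel capstone,
lead seat c9; `--supports` the crux). The extended capstone reduces, modulo `KZ.relations` and
with the uniform multiplier `24`, every word family `[Δ, x(t₀) y(t₁) z(t₂)]` of the level-two
weight-three descent (letters `a(u) = 1/u`, `b(u) = 1/(1−u)`, `c(u) = 1/(1+u)` on the decreasing
open simplex `Δ = {0 < t₂ < t₁ < t₀ < 1}`) to `α•[Z] + β•[Q] + γ•[B3]`, where `Z` is any box
representation of `1/(1−xyz)` (value `ζ(3)`), `Q` any box representation of `1/((1−xy)(1+z))`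
(value `ζ(2)·log 2`) and `B3` any box representation of `1/((1+x)(1+y)(1+z))` (value `(log 2)³`).
This file treats the four words

  `abc ↦ (−24, 36, 0)`, `acb ↦ (39, −36, 0)`, `cbb ↦ (21, −12, 4)`, `cbc ↦ (−6, 12, −4)`.

Chain of moves: congruence of the given word representation with the landed carrier of the same
word (rule (1b)); the simplex chart `(x, xy, xyz)` gives `[Z] = [aab]`, the prism chart
`(x, xy, z)` gives `[Q] = [P, ab ⊗ c]`, the sibling sub-goal `m3x_logCube_sub_six_ccc` gives
`[B3] = 6[ccc]`; and the integer certificates (symbols `A = [aab]`, `P = [P, ab ⊗ c]`,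
`J = [ccc]`, relation packages `rel1, rel2` (dilation), `rel3, rel4` (Möbius on `aac`, `aab`),
`rel5` (reflection), `rel6, rel7, rel8` (Möbius on `acc`, `cac`, `abc`), the shuffle
`S1 : [P, ab ⊗ c] = [abc] + [acb] + [cab]` and the shuffle relation
`relS : 4[acc] + 2[cac] = [abc] + [acb] + [cab]`)

  `24[abc] + 24A − 36P = 12rel1 − 12rel2 − 48rel3 − 48rel4 + 60rel5 − 24rel6 − 24rel8 − 36S1 + 12relS`,
  `24[acb] − 39A + 36P = −15rel1 + 6rel2 + 60rel3 + 60rel4 − 66rel5 + 24rel6 + 24rel8 + 36S1 − 12relS`,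
  `24[cbb] − 21A + 12P − 24J = −9rel1 + 6rel2 + 36rel3 + 12rel4 − 18rel5 − 24rel6 − 24rel7 + 12S1 − 12relS`,
  `24[cbc] + 6A − 12P + 24J = 6rel1 − 12rel2 − 24rel3 − 24rel4 + 36rel5 + 24rel7 − 12S1 + 12relS`.

Bookkeeping only; no independence input.
Sources: M. Kontsevich, D. Zagier, *Periods* (2001), §1.1–1.2 (rules (1), (2)).
No definitions are introduced.
-/

noncomputable section

open MeasureTheory Set
open Literature.NumberTheory.Transcendental Literature.NumberTheory.Transcendental.KZ
open Literature.ModelTheory.ExponentialFields (IsSemialgebraic)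

namespace Summit.KontsevichZagierPeriods.HurwitzMicroSectors.NormalFormPrinciple.PiBox.M3

/-- Integer combinations of ten members of `KZ.relations` are members. [folklore] -/
private theorem m3w2_comb {r₁ r₂ r₃ r₄ r₅ r₆ r₇ r₈ r₉ r₀ : FormalRep}
    (h₁ : r₁ ∈ relations) (h₂ : r₂ ∈ relations) (h₃ : r₃ ∈ relations) (h₄ : r₄ ∈ relations)
    (h₅ : r₅ ∈ relations) (h₆ : r₆ ∈ relations) (h₇ : r₇ ∈ relations) (h₈ : r₈ ∈ relations)
    (h₉ : r₉ ∈ relations) (h₀ : r₀ ∈ relations) (c₁ c₂ c₃ c₄ c₅ c₆ c₇ c₈ c₉ c₀ : ℤ) :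
    c₁ • r₁ + c₂ • r₂ + c₃ • r₃ + c₄ • r₄ + c₅ • r₅ + c₆ • r₆ + c₇ • r₇ + c₈ • r₈ + c₉ • r₉ +
      c₀ • r₀ ∈ relations :=
  relations.add_mem (relations.add_mem (relations.add_mem (relations.add_mem (relations.add_mem
    (relations.add_mem (relations.add_mem (relations.add_mem (relations.add_mem
    (relations.zsmul_mem h₁ _) (relations.zsmul_mem h₂ _)) (relations.zsmul_mem h₃ _))
    (relations.zsmul_mem h₄ _)) (relations.zsmul_mem h₅ _)) (relations.zsmul_mem h₆ _))
    (relations.zsmul_mem h₇ _)) (relations.zsmul_mem h₈ _)) (relations.zsmul_mem h₉ _))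
    (relations.zsmul_mem h₀ _)

/-- Final bookkeeping of one word reduction: `24[W] − (α[Z] + β[Q] + γ[B3])` is assembled from the
congruence `[W] ≡ [W₀]`, the certificate value `X ∈ relations`, and the three basis conversions
`[Z] ≡ [A]`, `[Q] ≡ [P]`, `[B3] ≡ 6[J]`. [folklore] -/
private theorem m3w2_close {w w₀ z q b a p j x : FormalRep} {α β γ : ℤ}
    (hW : w - w₀ ∈ relations) (hX : x ∈ relations) (eZ : z - a ∈ relations)
    (eQ : q - p ∈ relations) (eB : b - (6:ℤ) • j ∈ relations)
    (e : (24:ℕ) • w - (α • z + β • q + γ • b) =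
      (24:ℕ) • (w - w₀) + x - α • (z - a) - β • (q - p) - γ • (b - (6:ℤ) • j)) :
    (24:ℕ) • w - (α • z + β • q + γ • b) ∈ relations := by
  rw [e]
  exact relations.sub_mem (relations.sub_mem (relations.sub_mem (relations.add_mem
    (relations.nsmul_mem hW 24) hX) (relations.zsmul_mem eZ α)) (relations.zsmul_mem eQ β))
    (relations.zsmul_mem eB γ)

/-- **Stub (`m3x_reduce_words_2`; registered sub-goal of stmt-KontsevichZagierPeriods-3869, line
`SketchIdeator1`, layer `M3` words kernel).** For any box representations `Z` of `1/(1−xyz)`,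
`Q` of `1/((1−xy)(1+z))` and `B3` of `1/((1+x)(1+y)(1+z))`, every representation `W` on the
decreasing open simplex `Δ` of one of the words `abc`, `acb`, `cbb`, `cbc` satisfies
`24•[W] − (α•[Z] + β•[Q] + γ•[B3]) ∈ KZ.relations` with
`(α, β, γ) = (−24, 36, 0), (39, −36, 0), (21, −12, 4), (−6, 12, −4)` respectively
(values `24∫_Δ abc = −24ζ(3) + 6π²log 2`, etc.; obtained inside the calculus from one simplex
chart, one prism chart, the log-cube dissection and integer certificates over the landed
relation packages). [cite: KontsevichZagier2001, §1.2 rules (1), (2)] -/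
theorem m3x_reduce_words_2 :
    ∀ (Z Q B3 : IntegralRep 3),
      Z.domain = {x | ∀ i, x i ∈ Set.Ioo (0:ℝ) 1} → (Z.integrand = fun x => 1 / (1 - x 0 * x 1 * x 2)) →
      Q.domain = {x | ∀ i, x i ∈ Set.Ioo (0:ℝ) 1} → EqOn Q.integrand (fun x => 1 / ((1 - x 0 * x 1) * (1 + x 2))) Q.domain →
      B3.domain = {x | ∀ i, x i ∈ Set.Ioo (0:ℝ) 1} → (B3.integrand = fun x => 1 / ((1 + x 0) * (1 + x 1) * (1 + x 2))) →
        (∀ W : IntegralRep 3, W.domain = {t | 0 < t 2 ∧ t 2 < t 1 ∧ t 1 < t 0 ∧ t 0 < 1} →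
          EqOn W.integrand (fun t => 1 / t 0 * (1 / (1 - t 1)) * (1 / (1 + t 2))) W.domain →
          (24:ℕ) • of W - ((-24:ℤ) • of Z + (36:ℤ) • of Q + (0:ℤ) • of B3) ∈ relations) ∧
        (∀ W : IntegralRep 3, W.domain = {t | 0 < t 2 ∧ t 2 < t 1 ∧ t 1 < t 0 ∧ t 0 < 1} →
          EqOn W.integrand (fun t => 1 / t 0 * (1 / (1 + t 1)) * (1 / (1 - t 2))) W.domain →
          (24:ℕ) • of W - ((39:ℤ) • of Z + (-36:ℤ) • of Q + (0:ℤ) • of B3) ∈ relations) ∧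
        (∀ W : IntegralRep 3, W.domain = {t | 0 < t 2 ∧ t 2 < t 1 ∧ t 1 < t 0 ∧ t 0 < 1} →
          EqOn W.integrand (fun t => 1 / (1 + t 0) * (1 / (1 - t 1)) * (1 / (1 - t 2))) W.domain →
          (24:ℕ) • of W - ((21:ℤ) • of Z + (-12:ℤ) • of Q + (4:ℤ) • of B3) ∈ relations) ∧
        (∀ W : IntegralRep 3, W.domain = {t | 0 < t 2 ∧ t 2 < t 1 ∧ t 1 < t 0 ∧ t 0 < 1} →
          EqOn W.integrand (fun t => 1 / (1 + t 0) * (1 / (1 - t 1)) * (1 / (1 + t 2))) W.domain →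
          (24:ℕ) • of W - ((-6:ℤ) • of Z + (12:ℤ) • of Q + (-4:ℤ) • of B3) ∈ relations) := by
  intro Z Q B3 hZd hZi hQd hQi hB3d hB3i
  -- (1) the sixteen word carriers on `Δ` (the four `d`-words are not needed here)
  obtain ⟨AAB, ABB, AAC, ACC, ABC, ACB, CBB, CBC, CCB, CCC, CAB, CAC, -, -, -, -,
    ⟨hAABd, hAABi⟩, ⟨hABBd, hABBi⟩, ⟨hAACd, hAACi⟩, ⟨hACCd, hACCi⟩, ⟨hABCd, hABCi⟩,
    ⟨hACBd, hACBi⟩, ⟨hCBBd, hCBBi⟩, ⟨hCBCd, hCBCi⟩, ⟨hCCBd, hCCBi⟩, ⟨hCCCd, hCCCi⟩,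
    ⟨hCABd, hCABi⟩, ⟨hCACd, hCACi⟩, -, -, -, -⟩ := l2w3_carriers
  -- (2) `[Z] = [aab]` by the simplex chart: `1/(1−xyz) = a(x)·a(xy)·b(xyz)·(x²y)`
  have hZi' : EqOn Z.integrand (fun x => 1 / (1 - x 0 * x 1 * x 2)) Z.domain :=
    hZi ▸ fun _ _ => rfl
  have eZ : of Z - of AAB ∈ relations := by
    refine ebd_box_sub_simplex (fun t => 1 / t 0 * 1 / t 1 * (1 / (1 - t 2))) Z AAB hZd hAABd
      (hAABi ▸ fun _ _ => rfl) fun x hx => ?_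
    have hx' : ∀ i, x i ∈ Set.Ioo (0:ℝ) 1 := by rw [hZd] at hx; exact hx
    have h0 : x 0 ≠ 0 := (hx' 0).1.ne'
    have h1 : x 1 ≠ 0 := (hx' 1).1.ne'
    have h012m : 1 - x 0 * x 1 * x 2 ≠ 0 := by
      have := mul_lt_one_of_nonneg_of_lt_one_left (mul_pos (hx' 0).1 (hx' 1).1).le
        (mul_lt_one_of_nonneg_of_lt_one_left (hx' 0).1.le (hx' 0).2 (hx' 1).2.le) (hx' 2).2.le
      exact (sub_pos.2 this).ne'
    rw [hZi' hx]
    simp only [Matrix.cons_val_zero, Matrix.cons_val_one, Matrix.cons_val_two, Matrix.head_cons,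
      Matrix.tail_cons]
    field_simp
  -- (3) `[Q] = [P, ab ⊗ c]` by the prism chart `(x, xy, z)`; the prism carriers (from `3•Q`)
  obtain ⟨hprism, hexP⟩ := l2w3_box_sub_prism
  obtain ⟨⟨PABC, hPABCd, hPABCi⟩, ⟨PACC, hPACCd, hPACCi⟩⟩ :=
    hexP (Q.constMul ((3:ℕ) : ℝ) (isAlgebraic_nat 3))
      (by rw [IntegralRep.domain_constMul]; exact hQd) fun x hx => by
        rw [IntegralRep.domain_constMul] at hx
        simp only [IntegralRep.integrand_constMul, hQi hx]
        push_cast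
        ring
  have eQ : of Q - of PABC ∈ relations := by
    refine hprism (fun t => 1 / t 0 * (1 / (1 - t 1)) * (1 / (1 + t 2))) Q PABC hQd hPABCd
      (hPABCi ▸ fun _ _ => rfl) fun x hx => ?_
    have hx' : ∀ i, x i ∈ Set.Ioo (0:ℝ) 1 := by rw [hQd] at hx; exact hx
    have h0 : x 0 ≠ 0 := (hx' 0).1.ne'
    have h01 : 1 - x 0 * x 1 ≠ 0 :=
      (sub_pos.2 (mul_lt_one_of_nonneg_of_lt_one_left (hx' 0).1.le (hx' 0).2 (hx' 1).2.le)).ne'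
    have h2 : 1 + x 2 ≠ 0 := by linarith [(hx' 2).1]
    rw [hQi hx]
    simp only [Matrix.cons_val_zero, Matrix.cons_val_one, Matrix.cons_val_two, Matrix.head_cons,
      Matrix.tail_cons]
    field_simp
  -- (4) `[B3] = 6[ccc]` (the sibling sub-goal: cube → two prisms → three words each)
  have eB : of B3 - (6:ℤ) • of CCC ∈ relations :=
    m3x_logCube_sub_six_ccc B3 CCC hB3d (hB3i ▸ fun _ _ => rfl) hCCCd hCCCi
  -- (5) the landed relation packages
  have rel1 : (3:ℤ) • of AAB - (4:ℤ) • of AAC ∈ relations :=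
    l2w3_relations_dilation.1 AAB hAABd hAABi AAC hAACd hAACi
  have rel2 : of ABB - (2:ℤ) • of ABC - (2:ℤ) • of ACB + (2:ℤ) • of ACC ∈ relations :=
    l2w3_relations_dilation.2 ABB hABBd hABBi ABC hABCd hABCi ACB hACBd hACBi ACC hACCd hACCi
  have rel3 : of CBB + of CBC + of CCB + of CCC - of AAC ∈ relations :=
    l2w3_relations_moebius_one.1 AAC hAACd hAACi CBB hCBBd hCBBi CBC hCBCd hCBCi CCB hCCBd hCCBi
      CCC hCCCd hCCCi
  have rel4 : of ABB + of ABC + of ACB + of ACC - of CBB - of CBC - of CCB - of CCC - of AAB ∈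
      relations :=
    l2w3_relations_moebius_one.2 AAB hAABd hAABi ABB hABBd hABBi ABC hABCd hABCi ACB hACBd hACBi
      ACC hACCd hACCi CBB hCBBd hCBBi CBC hCBCd hCBCi CCB hCCBd hCCBi CCC hCCCd hCCCi
  have rel5 : of ABB - of AAB ∈ relations :=
    l2w3_relations_reflection.1 AAB hAABd hAABi ABB hABBd hABBi
  have rel6 : of CCB + of CCC - of ACC ∈ relations :=
    l2w3_relations_moebius_two.1 ACC hACCd hACCi CCB hCCBd hCCBi CCC hCCCd hCCCi
  have rel7 : of CBC + of CCC - of CAC ∈ relations :=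
    l2w3_relations_moebius_two.2.1 CAC hCACd hCACi CBC hCBCd hCBCi CCC hCCCd hCCCi
  have rel8 : of CAB + of CAC - of CCB - of CCC - of ABC ∈ relations :=
    l2w3_relations_moebius_two.2.2 ABC hABCd hABCi CAB hCABd hCABi CAC hCACd hCACi CCB hCCBd hCCBi
      CCC hCCCd hCCCi
  obtain ⟨shuf, relS⟩ := l2w3_relation_shuffle PABC PACC ABC ACB CAB ACC CAC hPABCd hPABCi
    hPACCd hPACCi hABCd hABCi hACBd hACBi hCABd hCABi hACCd hACCi hCACd hCACi
  -- every certificate below is an integer combination of these ten relations, in this order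
  have comb := m3w2_comb rel1 rel2 rel3 rel4 rel5 rel6 rel7 rel8 shuf relS
  refine ⟨?_, ?_, ?_, ?_⟩
  · -- the word `abc`: `24E + 24A − 36P =
    --   12rel1 − 12rel2 − 48rel3 − 48rel4 + 60rel5 − 24rel6 − 24rel8 − 36S1 + 12relS`
    intro W hWd hWi
    have hW : of W - of ABC ∈ relations :=
      of_sub_of_mem_relations_of_eqOn (hABCd.trans hWd.symm) fun t ht => by rw [hWi ht, hABCi]
    have key : (24:ℤ) • of ABC + (24:ℤ) • of AAB - (36:ℤ) • of PABC =
        (12:ℤ) • ((3:ℤ) • of AAB - (4:ℤ) • of AAC)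
        + (-12:ℤ) • (of ABB - (2:ℤ) • of ABC - (2:ℤ) • of ACB + (2:ℤ) • of ACC)
        + (-48:ℤ) • (of CBB + of CBC + of CCB + of CCC - of AAC)
        + (-48:ℤ) • (of ABB + of ABC + of ACB + of ACC - of CBB - of CBC - of CCB - of CCC - of AAB)
        + (60:ℤ) • (of ABB - of AAB)
        + (-24:ℤ) • (of CCB + of CCC - of ACC)
        + (0:ℤ) • (of CBC + of CCC - of CAC)
        + (-24:ℤ) • (of CAB + of CAC - of CCB - of CCC - of ABC)
        + (-36:ℤ) • (of PABC - of ABC - of ACB - of CAB)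
        + (12:ℤ) • ((4:ℤ) • of ACC + (2:ℤ) • of CAC - of ABC - of ACB - of CAB) := by
      abel
    have hmid : (24:ℤ) • of ABC + (24:ℤ) • of AAB - (36:ℤ) • of PABC ∈ relations := by
      rw [key]
      exact comb 12 (-12) (-48) (-48) 60 (-24) 0 (-24) (-36) 12
    exact m3w2_close hW hmid eZ eQ eB (by abel)
  · -- the word `acb`: `24F − 39A + 36P =
    --   −15rel1 + 6rel2 + 60rel3 + 60rel4 − 66rel5 + 24rel6 + 24rel8 + 36S1 − 12relS`
    intro W hWd hWi
    have hW : of W - of ACB ∈ relations :=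
      of_sub_of_mem_relations_of_eqOn (hACBd.trans hWd.symm) fun t ht => by rw [hWi ht, hACBi]
    have key : (24:ℤ) • of ACB - (39:ℤ) • of AAB + (36:ℤ) • of PABC =
        (-15:ℤ) • ((3:ℤ) • of AAB - (4:ℤ) • of AAC)
        + (6:ℤ) • (of ABB - (2:ℤ) • of ABC - (2:ℤ) • of ACB + (2:ℤ) • of ACC)
        + (60:ℤ) • (of CBB + of CBC + of CCB + of CCC - of AAC)
        + (60:ℤ) • (of ABB + of ABC + of ACB + of ACC - of CBB - of CBC - of CCB - of CCC - of AAB)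
        + (-66:ℤ) • (of ABB - of AAB)
        + (24:ℤ) • (of CCB + of CCC - of ACC)
        + (0:ℤ) • (of CBC + of CCC - of CAC)
        + (24:ℤ) • (of CAB + of CAC - of CCB - of CCC - of ABC)
        + (36:ℤ) • (of PABC - of ABC - of ACB - of CAB)
        + (-12:ℤ) • ((4:ℤ) • of ACC + (2:ℤ) • of CAC - of ABC - of ACB - of CAB) := by
      abel
    have hmid : (24:ℤ) • of ACB - (39:ℤ) • of AAB + (36:ℤ) • of PABC ∈ relations := by
      rw [key]
      exact comb (-15) 6 60 60 (-66) 24 0 24 36 (-12)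
    exact m3w2_close hW hmid eZ eQ eB (by abel)
  · -- the word `cbb`: `24G − 21A + 12P − 24J =
    --   −9rel1 + 6rel2 + 36rel3 + 12rel4 − 18rel5 − 24rel6 − 24rel7 + 12S1 − 12relS`
    intro W hWd hWi
    have hW : of W - of CBB ∈ relations :=
      of_sub_of_mem_relations_of_eqOn (hCBBd.trans hWd.symm) fun t ht => by rw [hWi ht, hCBBi]
    have key : (24:ℤ) • of CBB - (21:ℤ) • of AAB + (12:ℤ) • of PABC - (24:ℤ) • of CCC =
        (-9:ℤ) • ((3:ℤ) • of AAB - (4:ℤ) • of AAC)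
        + (6:ℤ) • (of ABB - (2:ℤ) • of ABC - (2:ℤ) • of ACB + (2:ℤ) • of ACC)
        + (36:ℤ) • (of CBB + of CBC + of CCB + of CCC - of AAC)
        + (12:ℤ) • (of ABB + of ABC + of ACB + of ACC - of CBB - of CBC - of CCB - of CCC - of AAB)
        + (-18:ℤ) • (of ABB - of AAB)
        + (-24:ℤ) • (of CCB + of CCC - of ACC)
        + (-24:ℤ) • (of CBC + of CCC - of CAC)
        + (0:ℤ) • (of CAB + of CAC - of CCB - of CCC - of ABC)
        + (12:ℤ) • (of PABC - of ABC - of ACB - of CAB)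
        + (-12:ℤ) • ((4:ℤ) • of ACC + (2:ℤ) • of CAC - of ABC - of ACB - of CAB) := by
      abel
    have hmid : (24:ℤ) • of CBB - (21:ℤ) • of AAB + (12:ℤ) • of PABC - (24:ℤ) • of CCC ∈
        relations := by
      rw [key]
      exact comb (-9) 6 36 12 (-18) (-24) (-24) 0 12 (-12)
    exact m3w2_close hW hmid eZ eQ eB (by abel)
  · -- the word `cbc`: `24H + 6A − 12P + 24J =
    --   6rel1 − 12rel2 − 24rel3 − 24rel4 + 36rel5 + 24rel7 − 12S1 + 12relS`
    intro W hWd hWi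
    have hW : of W - of CBC ∈ relations :=
      of_sub_of_mem_relations_of_eqOn (hCBCd.trans hWd.symm) fun t ht => by rw [hWi ht, hCBCi]
    have key : (24:ℤ) • of CBC + (6:ℤ) • of AAB - (12:ℤ) • of PABC + (24:ℤ) • of CCC =
        (6:ℤ) • ((3:ℤ) • of AAB - (4:ℤ) • of AAC)
        + (-12:ℤ) • (of ABB - (2:ℤ) • of ABC - (2:ℤ) • of ACB + (2:ℤ) • of ACC)
        + (-24:ℤ) • (of CBB + of CBC + of CCB + of CCC - of AAC)
        + (-24:ℤ) • (of ABB + of ABC + of ACB + of ACC - of CBB - of CBC - of CCB - of CCC - of AAB)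
        + (36:ℤ) • (of ABB - of AAB)
        + (0:ℤ) • (of CCB + of CCC - of ACC)
        + (24:ℤ) • (of CBC + of CCC - of CAC)
        + (0:ℤ) • (of CAB + of CAC - of CCB - of CCC - of ABC)
        + (-12:ℤ) • (of PABC - of ABC - of ACB - of CAB)
        + (12:ℤ) • ((4:ℤ) • of ACC + (2:ℤ) • of CAC - of ABC - of ACB - of CAB) := by
      abel
    have hmid : (24:ℤ) • of CBC + (6:ℤ) • of AAB - (12:ℤ) • of PABC + (24:ℤ) • of CCC ∈
        relations := by
      rw [key]
      exact comb 6 (-12) (-24) (-24) 36 0 24 0 (-12) 12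
    exact m3w2_close hW hmid eZ eQ eB (by abel)

end Summit.KontsevichZagierPeriods.HurwitzMicroSectors.NormalFormPrinciple.PiBox.M3
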